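import Summits.ResolutionOfSingularities.ResolutionOfSingularities.Theorems.PurelyInseparableDim4ScopeBlindRationalMap
import Mathlib.Algebra.CharP.Lemmas
import Mathlib.Data.ZMod.Basic
import HarnessLib

/-!
# STEP KIT over `𝔽₉`: a COMPUTABLE nine-element field for kernel certificates at `𝔽₉`-rational points,
# and its embeddings `𝔽₉ → L` into every field of characteristic `3` with a square root of `−1`

[OURS · instrument · counted 0.]  Census cell «res-dim4-pi» (D-0157 DOOR 2), seat res-dim4-p-8 g3 (the
«𝔽₉ lane»).  res-dim4-p-13's `StepKit` certifies edges of the tree's model `CentreBlowup.step` by `decide`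
over any field with decidable equality whose arithmetic the kernel can evaluate; res-dim4-p-4's `StepKit.F4`
(`…StepKitF4`) supplied the four-element field.  At `(p,q) = (3,3)` the first IRRATIONAL replies of the local
game live at `𝔽₉`-points (res-dim4-p-6 g2: at LOOP-E's `e3` the `x₁`-chart point `(0,0,i,0)`, `i² = −1`, is
equimultiple), and Mathlib's `GaloisField 3 2` is not computable.  This file supplies:

* §1 the type `F9 = {a + b·i : a, b ∈ 𝔽₃}` (pairs over `ZMod 3`, `i² = −1`) with its `Field`, `CharP _ 3`,
  `Fintype`, `DecidableEq` structure — a NEW type, so no Mathlib instance is overridden; ring axioms by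
  `ext` + `ring` in `ZMod 3`, inverses by `decide`;
* §2 for every field `L` of characteristic `3` and every `β : L` with `β·β = −1` the ring homomorphism
  **`F9.lift β hβ : F9 →+* L`**, `a + b·i ↦ a + b·β` (`lift_i : lift β hβ i = β`), the embedding
  `ι : ZMod 3 →+* F9`, and **`castHom_eq_lift_comp_ι`**: the structure map `ZMod 3 → L` factors through `F9`
  (ring maps out of `ZMod 3` are unique) — so every `𝔽₃`-state base-changed to `L` is the base change along
  `lift β hβ` of its `F9`-cast, and res-dim4-p-14's `BaseChange.step_map` moves `decide`-computed `F9`-steps to `L`;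
* §3 `SData.castF9` (an `𝔽₃`-presented state read over `F9`, coefficients through `ι`; `map_evalT` of `…ScopeBlindRationalMap`).

Nothing here proves or disproves resolution of singularities in dim ≥ 4 / char p.  bears_on:
LADDER-RESOLUTION:D157-DOOR2 (res-dim4-pi · 𝔽₉ lane · instrument).  Supports stmt-ResolutionOfSingularities-16155
(helper).
-/

-- house layout `Summits/<Summit>/<Problem>` doubles the namespace component (as in the Target file)
set_option linter.dupNamespace false

namespace Summit.ResolutionOfSingularities.ResolutionOfSingularities.Theorems.PIDim4

namespace StepKit

/-! ## 1. The computable field `F9` -/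

/-- The field with nine elements as pairs over `ZMod 3`: `⟨a, b⟩ = a + b·i`, `i² = −1` (`x² + 1` is irreducible
over `𝔽₃` since `−1` is not a square there). [folklore] -/
@[ext] structure F9 where
  /-- real part -/
  re : ZMod 3
  /-- imaginary part (coefficient of `i`) -/
  im : ZMod 3
  deriving DecidableEq, Repr

namespace F9

/-- `0`. [folklore] -/ instance : Zero F9 := ⟨⟨0, 0⟩⟩
/-- `1`. [folklore] -/ instance : One F9 := ⟨⟨1, 0⟩⟩
/-- `+`. [folklore] -/ instance : Add F9 := ⟨fun a b => ⟨a.re + b.re, a.im + b.im⟩⟩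
/-- `−`. [folklore] -/ instance : Neg F9 := ⟨fun a => ⟨-a.re, -a.im⟩⟩
/-- `*` (`i² = −1`). [folklore] -/ instance : Mul F9 := ⟨fun a b => ⟨a.re * b.re - a.im * b.im, a.re * b.im + a.im * b.re⟩⟩
/-- `⁻¹`: `(a + b i)⁻¹ = (a − b i)·N` with `N = a² + b² ∈ {1, 2}` self-inverse in `𝔽₃` (and `0⁻¹ = 0`). [folklore] -/
instance : Inv F9 := ⟨fun a => ⟨a.re * (a.re * a.re + a.im * a.im), -(a.im * (a.re * a.re + a.im * a.im))⟩⟩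

/-- `i = ⟨0, 1⟩`, the square root of `−1`. [folklore] -/
def i : F9 := ⟨0, 1⟩

/-- projection/simp lemma `zero_re`. [folklore] -/
@[simp] theorem zero_re : (0 : F9).re = 0 := rfl
/-- projection/simp lemma `zero_im`. [folklore] -/
@[simp] theorem zero_im : (0 : F9).im = 0 := rfl
/-- projection/simp lemma `one_re`. [folklore] -/
@[simp] theorem one_re : (1 : F9).re = 1 := rfl
/-- projection/simp lemma `one_im`. [folklore] -/
@[simp] theorem one_im : (1 : F9).im = 0 := rfl
/-- projection/simp lemma `add_re`. [folklore] -/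
@[simp] theorem add_re (a b : F9) : (a + b).re = a.re + b.re := rfl
/-- projection/simp lemma `add_im`. [folklore] -/
@[simp] theorem add_im (a b : F9) : (a + b).im = a.im + b.im := rfl
/-- projection/simp lemma `neg_re`. [folklore] -/
@[simp] theorem neg_re (a : F9) : (-a).re = -a.re := rfl
/-- projection/simp lemma `neg_im`. [folklore] -/
@[simp] theorem neg_im (a : F9) : (-a).im = -a.im := rfl
/-- projection/simp lemma `mul_re`. [folklore] -/
@[simp] theorem mul_re (a b : F9) : (a * b).re = a.re * b.re - a.im * b.im := rfl
/-- projection/simp lemma `mul_im`. [folklore] -/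
@[simp] theorem mul_im (a b : F9) : (a * b).im = a.re * b.im + a.im * b.re := rfl
/-- projection/simp lemma `i_re`. [folklore] -/
@[simp] theorem i_re : i.re = 0 := rfl
/-- projection/simp lemma `i_im`. [folklore] -/
@[simp] theorem i_im : i.im = 1 := rfl

/-- the nine elements. [folklore] -/
instance : Fintype F9 :=
  Fintype.ofEquiv (ZMod 3 × ZMod 3) ⟨fun p => ⟨p.1, p.2⟩, fun a => (a.re, a.im), fun _ => rfl, fun _ => rfl⟩

/-- `F9` is a commutative ring (axioms componentwise in `ZMod 3`). [folklore] -/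
instance : CommRing F9 where
  add_assoc a b c := by ext <;> simp <;> ring
  zero_add a := by ext <;> simp
  add_zero a := by ext <;> simp
  nsmul := nsmulRec
  add_comm a b := by ext <;> simp <;> ring
  left_distrib a b c := by ext <;> simp <;> ring
  right_distrib a b c := by ext <;> simp <;> ring
  zero_mul a := by ext <;> simp
  mul_zero a := by ext <;> simp
  mul_assoc a b c := by ext <;> simp <;> ring
  one_mul a := by ext <;> simp
  mul_one a := by ext <;> simp
  zsmul := zsmulRec
  neg_add_cancel a := by ext <;> simp
  mul_comm a b := by ext <;> simp <;> ring

/-- `F9` is a field (inverses checked on the nine elements). [folklore] -/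
instance : Field F9 where
  exists_pair_ne := ⟨0, 1, by decide⟩
  mul_inv_cancel := by decide
  inv_zero := by decide
  nnqsmul := _
  qsmul := _

/-- `F9` has characteristic `3`. [folklore] -/
instance : CharP F9 3 := (CharP.charP_iff_prime_eq_zero Nat.prime_three).mpr (by decide)

/-- `i² = −1`. [folklore] -/
theorem i_mul_i : i * i = -1 := by decide

/-- `F9` has exactly nine elements. [folklore] -/
theorem card_F9 : Fintype.card F9 = 9 := rfl

/-- every element is `⟨a, b⟩ = a + b·i` with the obvious coercion of `ZMod 3`-scalars. [folklore] -/
theorem eq_re_add_im_mul_i (a : F9) : a = ⟨a.re, 0⟩ + ⟨a.im, 0⟩ * i := by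
  ext <;> simp

/-! ## 2. Embeddings into fields of characteristic `3` containing `√−1` -/

/-- the embedding `𝔽₃ → F9`, `a ↦ a + 0·i`. [folklore] -/
def ι : ZMod 3 →+* F9 where
  toFun a := ⟨a, 0⟩
  map_one' := rfl
  map_mul' a b := by ext <;> simp
  map_zero' := rfl
  map_add' a b := by ext <;> simp

/-- projection/simp lemma `ι_re`. [folklore] -/
@[simp] theorem ι_re (a : ZMod 3) : (ι a).re = a := rfl
/-- projection/simp lemma `ι_im`. [folklore] -/
@[simp] theorem ι_im (a : ZMod 3) : (ι a).im = 0 := rfl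

section Lift

variable {L : Type} [Field L] [CharP L 3]

/-- **The embedding `F9 → L` determined by a square root `β` of `−1` in `L`**: `a + b·i ↦ a + b·β`
(`a, b ∈ 𝔽₃` read in `L` through the structure map `ZMod 3 → L`). [folklore] -/
def lift (β : L) (hβ : β * β = -1) : F9 →+* L where
  toFun a := ZMod.castHom (dvd_refl 3) L a.re + ZMod.castHom (dvd_refl 3) L a.im * β
  map_one' := by simp
  map_mul' a b := by
    simp only [mul_re, mul_im, map_sub, map_mul, map_add]
    linear_combination (-(ZMod.castHom (dvd_refl 3) L a.im * ZMod.castHom (dvd_refl 3) L b.im)) * hβ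
  map_zero' := by simp
  map_add' a b := by
    simp only [add_re, add_im, map_add]
    ring

/-- `lift β hβ` on a pair. [folklore] -/
theorem lift_apply (β : L) (hβ : β * β = -1) (a : F9) :
    lift β hβ a = ZMod.castHom (dvd_refl 3) L a.re + ZMod.castHom (dvd_refl 3) L a.im * β := rfl

/-- `lift β hβ i = β`. [folklore] -/
@[simp] theorem lift_i (β : L) (hβ : β * β = -1) : lift β hβ i = β := by
  simp [lift_apply]

/-- `lift β hβ` extends the structure map: `lift ∘ ι = (ZMod 3 → L)`. [folklore] -/
theorem lift_comp_ι (β : L) (hβ : β * β = -1) : (lift β hβ).comp ι = ZMod.castHom (dvd_refl 3) L :=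
  Subsingleton.elim _ _

/-- **The structure map `ZMod 3 → L` factors through `F9`** (ring maps out of `ZMod 3` are unique). [folklore] -/
theorem castHom_eq_lift_comp_ι (β : L) (hβ : β * β = -1) : ZMod.castHom (dvd_refl 3) L = (lift β hβ).comp ι :=
  Subsingleton.elim _ _

/-- a square root of `−1` read through `lift`: if `b·b = −1` then `b = lift b hb i`. [folklore] -/
theorem eq_lift_i {b : L} (hb : b * b = -1) : b = lift b hb i := (lift_i b hb).symm

end Lift

end F9

/-! ## 3. Coefficient maps on presented polynomials -/

section MapCoeffs

variable {n : ℕ}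

/-- an `𝔽₃`-presented state read over `F9` (same exponents, decorations; coefficients through `ι`). [folklore] -/
def SData.castF9 (s : SData n (ZMod 3)) : SData n F9 := ⟨s.L.map fun t => (t.1, F9.ι t.2), s.r, s.exc⟩

/-- the polynomial of the cast state is the base change along `ι`. [folklore] -/
theorem SData.castF9_toState_F (s : SData n (ZMod 3)) :
    s.castF9.toState.F = MvPolynomial.map F9.ι s.toState.F := by
  rw [SData.toState_F, SData.toState_F, map_evalT]; rfl

/-- decorations are unchanged. [folklore] -/
theorem SData.castF9_toState_r (s : SData n (ZMod 3)) : s.castF9.toState.r = s.toState.r := rfl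

/-- decorations are unchanged. [folklore] -/
theorem SData.castF9_toState_exc (s : SData n (ZMod 3)) : s.castF9.toState.exc = s.toState.exc := rfl

end MapCoeffs

/-! ## 4. Acceptance: arithmetic of `F9` by `decide` -/

namespace F9

/-- `(1 + i)·(1 − i) = 2 = −1`, `i⁻¹ = −i`, `(1+i)⁻¹ = −1 − i … ` — a handful of table entries, by `decide`. [folklore] -/
theorem tables_spot_check :
    (⟨1, 1⟩ : F9) * ⟨1, 2⟩ = ⟨2, 0⟩ ∧ (i)⁻¹ = -i ∧ (⟨1, 1⟩ : F9)⁻¹ * ⟨1, 1⟩ = 1 ∧ i ^ 4 = 1 ∧ i ^ 2 = ⟨2, 0⟩ := by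
  decide

/-- Frobenius `c ↦ c³` is the conjugation `a + b i ↦ a − b i`. [folklore] -/
theorem frobenius_eq_conj : ∀ c : F9, c ^ 3 = ⟨c.re, -c.im⟩ := by
  decide

end F9

end StepKit

end Summit.ResolutionOfSingularities.ResolutionOfSingularities.Theorems.PIDim4
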